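import Summits.AtomisticToContinuum.Crystallization.Theses.IsometryAtoms

/-!
# Birth certificate (BC3) — crux `IsometryAtoms.MinimisingLawsCohesive` (stmt-AtomisticToContinuum-15777)

Skeleton registrar `planner-skel-stmt-AtomisticToContinuum-15777-0` (2026-08-17), route
`route-AtomisticToContinuum-IsometryAtoms` (sub-problem `Crystallization`; re-audit bin REPAIRABLE,
`bc3_audit: null`). Published as `Cruxes/MinimisingLawsCohesive/Lines/birth.lean`; no other line,
idea, `Disproof.lean` or Negative lemma exists for this crux at registration (`ledger crux ls`: no
workfiles).

THE CRUX (COHESION, rank 3). For every hard core `δ > 0` and every probability law `P` on rooted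
configurations `μ : Measure ℝ³` that is a.s. `IsRootedHardCore δ`, `IsPointStationaryLaw` (Mecke /
mass transport) and MINIMISING (`∫ rootEnergy V_LJ dP ≤ e* := ⨅_Q e(Q)` over periodic `Q`):
`P`-a.s. the configuration is relatively dense, `∃ R₀, ∀ z, ∃ y, μ {y} ≠ 0 ∧ dist z y ≤ R₀`.

## The line — EXPOSURE PRICING + HYPERFINITE (random-grid) TRANSFER + MECKE / SLIDING BALL

Call a particle `y` of a configuration **`R`-exposed** if it lies within distance `R + 1` of the
centre of an EMPTY open ball of radius `R` (a cavity, a pore, a crack of width `≥ 2R`, or the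
outside of a film / rod / cluster); for the root of `μ` this is the event
`A_R = {∃ z, ‖z‖ ≤ R + 1 ∧ μ (ball z R) = 0}`, for particle `i` of a finite configuration `x` it is
`∃ z, dist (x i) z ≤ R + 1 ∧ ∀ j, R ≤ dist (x j) z`. Three mechanisms of different physics:

* `stub_exposurePremium` — POSITIVE SURFACE TENSION IN EXPOSED-SITE FORM (load-bearing, open,
  deterministic, finite `n` only): `∃ R₁ > 0, ∃ κ > 0` such that for every INJECTIVE configuration
  of `n` points in `ℝ³`, `n·e* + κ·#{R₁-exposed particles} ≤ U(x)`. The `κ = 0` half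
  `n·e* ≤ U(x)` is the tree theorem `ChargedEnergyGapNegative.card_mul_eStar_le` (periodisation +
  `crysEnergyLimit`, item 0626 proved); `κ > 0` says that every site adjacent to a cavity of radius
  `≥ R₁` (or to the vacuum) carries, ON AVERAGE OVER THE WHOLE CONFIGURATION, a definite share of the
  non-negative excess `U(x) − n·e*` — the Heitmann–Radin / Theil surface-energy lower bound
  `E(N) − N e* ≳ N^{2/3}` in three dimensions, with interior cavities counted. It is GLOBAL, not
  sitewise: the sitewise pricings are refuted in this sub-problem (negatives stmt-17253
  one-multiplier pricing, stmt-4146 effective local Hales) because single sites may sit below `e*`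
  (one-centre frustration slack); a total price is what survives. `R₁` is existential: vacancies,
  divacancies and thin cracks (holes of radius `< R₁`) are NOT charged, only cavities a ball of
  radius `R₁` fits into, so the statement weakens (and stays sufficient) as `R₁` grows.
* `stub_premiumTransfer` — HYPERFINITE TRANSFER TO PALM LAWS (provable; Palm theory + `r⁻⁶` tails):
  GIVEN the premium inequality at `(R₁, κ)`, every minimising point-stationary `δ`-hard-core law has
  `P(A_{R₁}) = 0` (a.s. the root is not `R₁`-exposed). Proof route: tile `ℝ³` by the randomly
  shifted cubic grid of mesh `L` (shift `u` uniform on the torus `[0,L)³`, an averaging device inside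
  the Mecke identity — this is hyperfiniteness of point-stationary laws of `ℝ³`, valid with NO
  intensity / finite-cell-volume assumption); apply the premium to the finite window
  `W = supp μ ∩ Q_u(0)` (a particle `R₁`-exposed in `μ` is `R₁`-exposed in `W ⊆ μ`); write
  `U(W) = Σ_{y ∈ W} rootEnergy(θ_y μ) − ½ I(W, μ ∖ W)` and bound the cut by
  `½(C_δ·#{y ∈ W : dist(y, ∂Q) < T} + C_δ T⁻³·#W)` (`V_LJ ≥ −t⁻⁶/6`, shell counting in a
  `δ`-separated set); divide by `#W ≥ 1` and take expectations: the cell-averaged Mecke identity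
  `E[(1/#W) Σ_{y ∈ W} F(θ_y μ, u − y)] = E[F(μ, u)]` turns it into
  `E[rootEnergy] − e* − κ P(A_{R₁}) + ½ C_δ · 6T/L + ½ C_δ T⁻³ ≥ 0`; `L → ∞`, then `T → ∞`, then
  `E[rootEnergy] ≤ e*` give `κ P(A_{R₁}) ≤ 0`. (Integrability of `rootEnergy` is forced by the
  minimising hypothesis itself: a junk integral `0` is not `≤ e* < 0`, `BlancLewin2015_8_holds`.)
* `stub_exposedRootOfHole` — WHAT HAPPENS SOMEWHERE HAPPENS AT THE ROOT + SLIDING BALL (provable;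
  no energy): for a point-stationary a.s. `δ`-hard-core law and `R > 0`, if a.s. the ROOT is not
  `R`-exposed then a.s. EVERY point `z ∈ ℝ³` is within `R` of a particle. Mecke with
  `g(μ, y) = 1_N(θ_y μ)·1{‖y‖ ≤ n}` (`N ⊇ A_R` a measurable `P`-null set) gives
  `E #{y ∈ μ ∩ B̄_n : θ_y μ ∈ N} = E[1_N(μ)·μ(B̄_n)] = 0`, so a.s. NO particle is `R`-exposed; and
  if some open ball `B(z, R)` were empty, sliding its centre along the segment from `z` to the root
  `0 ∈ supp μ` until first contact (local finiteness: `f(t) = min_y dist(y, (1−t)z)` is continuous,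
  `f(0) ≥ R > 0 = f(1)`) produces an empty `R`-ball with a particle ON its boundary — an
  `R`-exposed particle. Contradiction; hence `∀ z, ∃ y ∈ supp μ, dist z y < R`.

COMPOSITION (`MinimisingLawsCohesive_of`, sorry-free, concludes the route decl BY NAME): take
`(R₁, κ)` from the premium; the transfer kills `A_{R₁}` a.s.; the root-to-everywhere stub then
gives a.s. `∀ z, ∃ y, μ {y} ≠ 0 ∧ dist z y ≤ R₁`, i.e. the crux with the UNIFORM radius
`R₀ := R₁` (the line proves the formally stronger "uniformly relatively dense a.s.", as it must: a
point-stationary law cannot charge a zero-density family of unboundedly large holes without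
charging `A_{R₁}`).

WHICH HYPOTHESIS EACH STUB SPENDS: the minimising inequality `∫ rootEnergy ≤ e*` enters ONLY
`stub_premiumTransfer` (as the last step `κ·P(A) ≤ E[rootEnergy] − e* ≤ 0`); point-stationarity
enters stubs 2 and 3 (cell-averaged Mecke; somewhere-to-root Mecke); the hard core `δ > 0` gives
finiteness of windows and the `T⁻³` tail (stub 2) and local finiteness for the sliding ball
(stub 3); `IsProbabilityMeasure` normalises `E[·]`. Stub 1 uses no law at all.

CALIBRATION (§5, sorry-free): the two exposure notions agree — rooting an injective finite
configuration at particle `i` (`count|{x_k − x_i}`), the root is `R`-exposed iff particle `i` is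
`R`-exposed in `x` (`rootExposed_rooted_iff`); and the composition's output is the uniform-radius
strengthening `UniformlyCohesive R₁ → MinimisingLawsCohesive` (an `example` in §5).

DISPROOF USED: none on file (no `Cruxes/MinimisingLawsCohesive/Disproof.lean`, no Negative lemmas,
no dead lines at registration). Negatives index of the summit (20 entries, 4 on this sub-problem:
gapped shell census 15929, one-multiplier sitewise pricing 17253, effective local Hales 4146,
one-grain gluing 3506): none is an instance of a stub — stub 1 prices a GLOBAL count against the
TOTAL excess with `R₁` existential and tolerance `1`, stubs 2–3 are Palm-theoretic.

BC3 PROBES (registrar session 2026-08-17, files `bc/stub_*_probe.lean`, `bc/probes_split.lean` in the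
registrar's folder; raw messages in its NOTES.md `birth-certificate:`): for each of the three stubs `S`,
`set_option maxHeartbeats 400000 in example : S → MinimisingLawsCohesive` and `example : S → Crystallization`
by `first | exact? | simpa | aesop` FAIL (lean rc 1 ×3 files): `stub_exposurePremium → crux` and
`stub_premiumTransfer → crux` end in `unsolved goals ⊢ MinimisingLawsCohesive` after aesop's exhaustive
search; the other four pairs exhaust the 400000-heartbeat ceiling inside `exact?`, and re-run with
`simpa` and `aesop` separately (8 examples) fail with "Tactic `assumption` failed" / "aesop: failed to
prove the goal after exhaustive search". No stub is cheaply the crux or the summit.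
-/

noncomputable section

namespace Summit.AtomisticToContinuum.Crystallization.Cruxes.MinimisingLawsCohesive.Birth

open MeasureTheory
open Literature.MathematicalPhysics.StatisticalMechanics Literature.Probability.Process
open Summit.AtomisticToContinuum.Crystallization.Theses.IsometryAtoms (MinimisingLawsCohesive)

/-! ## §1 The three statements (named Props; the registered stubs of §2 restate them verbatim) -/

/-- **(S1) Exposure premium** — positive surface tension of Lennard-Jones matter in exposed-site
form: some cavity scale `R₁ > 0` and price `κ > 0` make
`n·e* + κ·#{i : particle i lies within R₁ + 1 of the centre of an empty open R₁-ball} ≤ U(x)`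
for every injective finite configuration `x` of `ℝ³` (`e* = ⨅_Q e_LJ(Q)` over periodic `Q`). -/
def ExposurePremium : Prop :=
  ∃ R₁ : ℝ, 0 < R₁ ∧ ∃ κ : ℝ, 0 < κ ∧ ∀ (n : ℕ) (x : Fin n → EuclideanSpace ℝ (Fin 3)),
    Function.Injective x →
      (n : ℝ) * (⨅ Q : PeriodicConfiguration 3, Q.energyPerParticle lennardJones) +
        κ * (Nat.card {i : Fin n // ∃ z : EuclideanSpace ℝ (Fin 3),
          dist (x i) z ≤ R₁ + 1 ∧ ∀ j : Fin n, R₁ ≤ dist (x j) z} : ℝ) ≤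
      interactionEnergy lennardJones x

/-- The premium inequality at a GIVEN scale `R₁` and price `κ` (the hypothesis of the transfer). -/
def PremiumAt (R₁ κ : ℝ) : Prop :=
  ∀ (n : ℕ) (x : Fin n → EuclideanSpace ℝ (Fin 3)), Function.Injective x →
    (n : ℝ) * (⨅ Q : PeriodicConfiguration 3, Q.energyPerParticle lennardJones) +
      κ * (Nat.card {i : Fin n // ∃ z : EuclideanSpace ℝ (Fin 3),
        dist (x i) z ≤ R₁ + 1 ∧ ∀ j : Fin n, R₁ ≤ dist (x j) z} : ℝ) ≤
    interactionEnergy lennardJones x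

/-- **(S2) Premium transfer** — hyperfiniteness of point-stationary laws of `ℝ³`: given the
premium at `(R₁, κ)`, `κ > 0`, every minimising point-stationary a.s. `δ`-hard-core probability law
has a.s. a NON-exposed root at scale `R₁`. -/
def PremiumTransfer : Prop :=
  ∀ R₁ κ : ℝ, 0 < κ → PremiumAt R₁ κ →
    ∀ δ : ℝ, 0 < δ → ∀ P : Measure (Measure (EuclideanSpace ℝ (Fin 3))), IsProbabilityMeasure P →
      (∀ᵐ μ ∂P, IsRootedHardCore δ μ) → IsPointStationaryLaw P →
      (∫ μ, rootEnergy lennardJones μ ∂P) ≤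
        (⨅ Q : PeriodicConfiguration 3, Q.energyPerParticle lennardJones) →
      ∀ᵐ μ ∂P, ¬ ∃ z : EuclideanSpace ℝ (Fin 3), ‖z‖ ≤ R₁ + 1 ∧ μ (Metric.ball z R₁) = 0

/-- **(S3) Exposed root of a hole** — somewhere-to-root Mecke transfer + sliding ball: under a
point-stationary a.s. `δ`-hard-core probability law, if a.s. the root is not `R`-exposed (`R > 0`)
then a.s. every point of space is within `R` of a particle. -/
def ExposedRootOfHole : Prop :=
  ∀ δ : ℝ, 0 < δ → ∀ P : Measure (Measure (EuclideanSpace ℝ (Fin 3))), IsProbabilityMeasure P →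
    (∀ᵐ μ ∂P, IsRootedHardCore δ μ) → IsPointStationaryLaw P →
    ∀ R : ℝ, 0 < R →
      (∀ᵐ μ ∂P, ¬ ∃ z : EuclideanSpace ℝ (Fin 3), ‖z‖ ≤ R + 1 ∧ μ (Metric.ball z R) = 0) →
      ∀ᵐ μ ∂P, ∀ z : EuclideanSpace ℝ (Fin 3), ∃ y : EuclideanSpace ℝ (Fin 3),
        μ {y} ≠ 0 ∧ dist z y ≤ R

/-- The uniform-radius strengthening of the crux that the line actually proves. -/
def UniformlyCohesive (R₀ : ℝ) : Prop :=
  ∀ δ : ℝ, 0 < δ → ∀ P : Measure (Measure (EuclideanSpace ℝ (Fin 3))), IsProbabilityMeasure P →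
    (∀ᵐ μ ∂P, IsRootedHardCore δ μ) → IsPointStationaryLaw P →
    (∫ μ, rootEnergy lennardJones μ ∂P) ≤
      (⨅ Q : PeriodicConfiguration 3, Q.energyPerParticle lennardJones) →
    ∀ᵐ μ ∂P, ∀ z : EuclideanSpace ℝ (Fin 3), ∃ y : EuclideanSpace ℝ (Fin 3),
      μ {y} ≠ 0 ∧ dist z y ≤ R₀

/-! ## §2 The registered stubs (`sorry` lives only in these three theorems)

Each `stub_*` restates its statement of §1 VERBATIM over tree declarations (fully qualified), so
that the signature recorded by `ledger skeleton check` elaborates in the route context. -/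

/-- **STUB (S1)** — exposure premium (XL, open: the `κ > 0` surface-tension half; `κ = 0` is
`ChargedEnergyGapNegative.card_mul_eStar_le`). FALSE without `Function.Injective` (stacked copies
of a crystal ball: `V_LJ 0 = 0` junk makes `U` quadratic in the multiplicity). -/
theorem stub_exposurePremium :
    ∃ R₁ : ℝ, 0 < R₁ ∧ ∃ κ : ℝ, 0 < κ ∧ ∀ (n : ℕ) (x : Fin n → EuclideanSpace ℝ (Fin 3)),
      Function.Injective x →
        (n : ℝ) * (⨅ Q : Literature.MathematicalPhysics.StatisticalMechanics.PeriodicConfiguration 3,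
            Q.energyPerParticle Literature.MathematicalPhysics.StatisticalMechanics.lennardJones) +
          κ * (Nat.card {i : Fin n // ∃ z : EuclideanSpace ℝ (Fin 3),
            dist (x i) z ≤ R₁ + 1 ∧ ∀ j : Fin n, R₁ ≤ dist (x j) z} : ℝ) ≤
        Literature.MathematicalPhysics.StatisticalMechanics.interactionEnergy
          Literature.MathematicalPhysics.StatisticalMechanics.lennardJones x := by
  sorry

example : ExposurePremium := stub_exposurePremium

/-- **STUB (S2)** — premium transfer (L, provable: randomly shifted grid = hyperfinite exhaustion
inside the Mecke identity, cut cost `≤ ½(C_δ·#shell + C_δ T⁻³·#W)`, then `L → ∞`, `T → ∞`). -/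
theorem stub_premiumTransfer :
    ∀ R₁ κ : ℝ, 0 < κ →
      (∀ (n : ℕ) (x : Fin n → EuclideanSpace ℝ (Fin 3)), Function.Injective x →
        (n : ℝ) * (⨅ Q : Literature.MathematicalPhysics.StatisticalMechanics.PeriodicConfiguration 3,
            Q.energyPerParticle Literature.MathematicalPhysics.StatisticalMechanics.lennardJones) +
          κ * (Nat.card {i : Fin n // ∃ z : EuclideanSpace ℝ (Fin 3),
            dist (x i) z ≤ R₁ + 1 ∧ ∀ j : Fin n, R₁ ≤ dist (x j) z} : ℝ) ≤
        Literature.MathematicalPhysics.StatisticalMechanics.interactionEnergy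
          Literature.MathematicalPhysics.StatisticalMechanics.lennardJones x) →
      ∀ δ : ℝ, 0 < δ →
        ∀ P : MeasureTheory.Measure (MeasureTheory.Measure (EuclideanSpace ℝ (Fin 3))),
          MeasureTheory.IsProbabilityMeasure P →
          (∀ᵐ μ ∂P, Literature.Probability.Process.IsRootedHardCore δ μ) →
          Literature.Probability.Process.IsPointStationaryLaw P →
          (∫ μ, Literature.MathematicalPhysics.StatisticalMechanics.rootEnergy
              Literature.MathematicalPhysics.StatisticalMechanics.lennardJones μ ∂P) ≤
            (⨅ Q : Literature.MathematicalPhysics.StatisticalMechanics.PeriodicConfiguration 3,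
              Q.energyPerParticle Literature.MathematicalPhysics.StatisticalMechanics.lennardJones) →
          ∀ᵐ μ ∂P, ¬ ∃ z : EuclideanSpace ℝ (Fin 3), ‖z‖ ≤ R₁ + 1 ∧ μ (Metric.ball z R₁) = 0 := by
  sorry

example : PremiumTransfer := stub_premiumTransfer

/-- **STUB (S3)** — exposed root of a hole (M, provable: Mecke with `1_N(θ_y μ)·1{‖y‖ ≤ n}` for a
measurable null `N ⊇ A_R`, then the sliding-ball first-contact argument in a locally finite set). -/
theorem stub_exposedRootOfHole :
    ∀ δ : ℝ, 0 < δ →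
      ∀ P : MeasureTheory.Measure (MeasureTheory.Measure (EuclideanSpace ℝ (Fin 3))),
        MeasureTheory.IsProbabilityMeasure P →
        (∀ᵐ μ ∂P, Literature.Probability.Process.IsRootedHardCore δ μ) →
        Literature.Probability.Process.IsPointStationaryLaw P →
        ∀ R : ℝ, 0 < R →
          (∀ᵐ μ ∂P, ¬ ∃ z : EuclideanSpace ℝ (Fin 3), ‖z‖ ≤ R + 1 ∧ μ (Metric.ball z R) = 0) →
          ∀ᵐ μ ∂P, ∀ z : EuclideanSpace ℝ (Fin 3), ∃ y : EuclideanSpace ℝ (Fin 3),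
            μ {y} ≠ 0 ∧ dist z y ≤ R := by
  sorry

example : ExposedRootOfHole := stub_exposedRootOfHole

/-! ## §3 Name-keyed aliases (hypotheses of the composition)

`Registered.stub_X` is the statement of `stub_X` under the registered stub's short name, so that
the skeleton audit (`#h21_check_skeleton`: hypotheses admissible iff registered stubs BY NAME)
accepts `MinimisingLawsCohesive_of : Registered.stub_… → … → MinimisingLawsCohesive`. -/
namespace Registered

/-- Alias of `ExposurePremium` keyed by the registered stub name. -/
abbrev stub_exposurePremium : Prop := ExposurePremium
/-- Alias of `PremiumTransfer` keyed by the registered stub name. -/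
abbrev stub_premiumTransfer : Prop := PremiumTransfer
/-- Alias of `ExposedRootOfHole` keyed by the registered stub name. -/
abbrev stub_exposedRootOfHole : Prop := ExposedRootOfHole

end Registered

/-! ## §4 The composition (kernel-checked, no sorry) -/

/-- The three stubs give the UNIFORM-radius statement: a.s. every point of space is within `R₁`
of a particle, `R₁` the cavity scale of the premium. -/
theorem uniformlyCohesive_of (h₁ : Registered.stub_exposurePremium)
    (h₂ : Registered.stub_premiumTransfer) (h₃ : Registered.stub_exposedRootOfHole) :
    ∃ R₁ : ℝ, 0 < R₁ ∧ UniformlyCohesive R₁ := by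
  obtain ⟨R₁, hR₁, κ, hκ, hprem⟩ := h₁
  refine ⟨R₁, hR₁, fun δ hδ P hP hhc hst hE => ?_⟩
  -- the transfer kills the exposed-root event at scale `R₁` …
  have hroot := h₂ R₁ κ hκ hprem δ hδ P hP hhc hst hE
  -- … and "somewhere ⇒ at the root" + the sliding ball makes every point `R₁`-close to a particle
  exact h₃ δ hδ P hP hhc hst R₁ hR₁ hroot

/-- **`MinimisingLawsCohesive_of`** — the three registered stubs give the crux BY NAME:
premium `(R₁, κ)` ↦ a.s. non-exposed root (transfer) ↦ a.s. `∀ z, ∃ y ∈ μ, dist z y ≤ R₁`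
(root-to-everywhere) ↦ `R₀ := R₁`. (The only theorem of this file whose conclusion is the crux, so
that the skeleton audit has exactly one candidate.) -/
theorem MinimisingLawsCohesive_of (h₁ : Registered.stub_exposurePremium)
    (h₂ : Registered.stub_premiumTransfer) (h₃ : Registered.stub_exposedRootOfHole) :
    MinimisingLawsCohesive := by
  obtain ⟨R₁, -, hU⟩ := uniformlyCohesive_of h₁ h₂ h₃
  intro δ hδ P hP hhc hst hE
  filter_upwards [hU δ hδ P hP hhc hst hE] with μ hμ
  exact ⟨R₁, hμ⟩

/-- Wiring check: the registered stubs feed `MinimisingLawsCohesive_of` as stated. -/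
example : MinimisingLawsCohesive :=
  MinimisingLawsCohesive_of stub_exposurePremium stub_premiumTransfer stub_exposedRootOfHole

/-! ## §5 Calibration (sorry-free): uniform radius ⇒ the crux; the two exposure notions agree -/

/-- A uniform radius is in particular a radius: `UniformlyCohesive R₀ → MinimisingLawsCohesive`
(an `example`, not a declaration, so that `MinimisingLawsCohesive_of` stays the unique theorem
concluding the crux). -/
example {R₀ : ℝ} (h : UniformlyCohesive R₀) : MinimisingLawsCohesive := by
  intro δ hδ P hP hhc hst hE
  filter_upwards [h δ hδ P hP hhc hst hE] with μ hμ
  exact ⟨R₀, hμ⟩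

/-- For a counting measure `count|S`, an open ball is null iff it misses `S`. -/
theorem count_restrict_ball_eq_zero_iff (S : Set (EuclideanSpace ℝ (Fin 3)))
    (z : EuclideanSpace ℝ (Fin 3)) (R : ℝ) :
    (Measure.count : Measure (EuclideanSpace ℝ (Fin 3))).restrict S (Metric.ball z R) = 0 ↔
      ∀ y ∈ S, R ≤ dist y z := by
  rw [Measure.restrict_apply Metric.isOpen_ball.measurableSet, Measure.count_eq_zero_iff,
    Set.eq_empty_iff_forall_notMem]
  constructor
  · intro h y hy
    by_contra hlt
    exact h y ⟨Metric.mem_ball.2 (lt_of_not_ge hlt), hy⟩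
  · rintro h y ⟨hyb, hyS⟩
    exact absurd (Metric.mem_ball.1 hyb) (not_lt.2 (h y hyS))

/-- **The root of `x` seen from particle `i` is `R`-exposed iff particle `i` is `R`-exposed in
`x`**: the Palm-side event of stubs 2–3 and the finite-configuration count of stub 1 are the same
notion (translate the cavity centre by `x i`). -/
theorem rootExposed_rooted_iff {n : ℕ} (x : Fin n → EuclideanSpace ℝ (Fin 3)) (i : Fin n) (R : ℝ) :
    (∃ z : EuclideanSpace ℝ (Fin 3), ‖z‖ ≤ R + 1 ∧
        (Measure.count : Measure (EuclideanSpace ℝ (Fin 3))).restrict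
          (Set.range fun k => x k - x i) (Metric.ball z R) = 0) ↔
      ∃ z : EuclideanSpace ℝ (Fin 3), dist (x i) z ≤ R + 1 ∧ ∀ j : Fin n, R ≤ dist (x j) z := by
  constructor
  · rintro ⟨z, hz, h0⟩
    rw [count_restrict_ball_eq_zero_iff] at h0
    refine ⟨z + x i, ?_, fun j => ?_⟩
    · rw [dist_comm, dist_eq_norm]
      simpa using hz
    · have := h0 (x j - x i) ⟨j, rfl⟩
      rw [dist_eq_norm] at this ⊢
      have e : x j - (z + x i) = x j - x i - z := by abel
      rw [e]
      exact this
  · rintro ⟨z, hz, h0⟩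
    refine ⟨z - x i, ?_, ?_⟩
    · rw [dist_eq_norm] at hz
      have e : z - x i = -(x i - z) := by abel
      rw [e, norm_neg]
      exact hz
    · rw [count_restrict_ball_eq_zero_iff]
      rintro _ ⟨j, rfl⟩
      have := h0 j
      rw [dist_eq_norm] at this ⊢
      have e : x j - x i - (z - x i) = x j - z := by abel
      rw [e]
      exact this

end Summit.AtomisticToContinuum.Crystallization.Cruxes.MinimisingLawsCohesive.Birth

end
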